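import Literature.Topology.FourManifolds.KnotAlexanderPresentation
import Literature.Topology.FourManifolds.CutRankCount
import HarnessLib

/-!
# A square presentation of the Alexander module of a knot from a bicollared Seifert surface

Topic `Literature/Topology/FourManifolds`. Combining the assembly theorem
`Knot.TubularNbhd.exists_alexander_presentation_of_circleBandData` with the rank count
`CircleBandData.nonempty_basis_Y` (`CutRankCount.lean`): for a knot `K ⊂ S³` with a circle-valued
map `f : S³ ∖ K → S¹` along which the meridian winds once and a band about the connected cut
`L = {f = 1}` trivialised over the angle, IF `H₂(S³ ∖ K; ℤ) = 0`, the pieces `{f ≠ 1}`, `{f ≠ -1}`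
carry no first homology of `S³ ∖ K`, and `H₁(L; ℤ) ≅ ℤʳ`, then the Alexander module of
`π₁(S³ ∖ K)` has a **square** presentation `ℤ[π₁ᵃᵇ]ʳ → ℤ[π₁ᵃᵇ]ʳ → G'/G'' → 0` by a matrix
`B − tA` with integer `r × r` matrices `A`, `B` (Rolfsen (1976), §8.C; Lickorish (1997), Thm. 6.5:
`r = 2g`, `B = V`, `A = Vᵀ` for the linking-dual bases). The generators of `H₁(N)`, their lifts to
the two sides and the matrices are manufactured here from the bases (`j₊`, `j₋` are bijective).
Everything is proved; no named fact is introduced.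

## References

* D. Rolfsen, *Knots and Links*, Publish or Perish (1976), §8.C. [Rolfsen1976]
* W. B. R. Lickorish, *An Introduction to Knot Theory*, GTM 175 (1997), Thm. 6.5. [Lickorish1997]
-/

noncomputable section

open Set Function CategoryTheory Limits
open scoped LaurentPolynomial Real
open Literature.AlgebraicTopology.SingularHomology
open Literature.Topology.FourManifolds.CircleMaps
open Literature.Topology.FourManifolds.CircleMaps.CyclicCover

namespace Literature.Topology.FourManifolds

namespace Knot.TubularNbhd

variable {K : Knot} (ν : Knot.TubularNbhd K)

set_option maxHeartbeats 1600000 in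
/-- **A square presentation of the Alexander module** (Rolfsen 1976, §8.C; Lickorish 1997,
Thm. 6.5): see the module docstring. [cite: Rolfsen1976, §8.C] -/
theorem exists_square_presentation_of_circleBandData (f : C(K.complement, Circle))
    (B : CircleBandData f) [PathConnectedSpace ↥{x : K.complement | f x = Circle.exp 0}]
    (h₀ : winding f ν.meridian = 1) {r : ℕ}
    (bL : Module.Basis (Fin r) ℤ (singularHomology ℤ ℤ ↥{x : K.complement | f x = Circle.exp 0} 1))
    (h2 : IsZero (singularHomology ℤ ℤ K.complement 2))
    (hY : singularHomology.map ℤ ℤ (subsetIncl B.cutData.Y) 1 = 0)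
    (hN : singularHomology.map ℤ ℤ (subsetIncl B.cutData.N) 1 = 0) :
    ∃ (e' : Abelianization (FundamentalGroup K.complement ν.basePoint) ≃* Multiplicative ℤ)
      (pres : (Fin r → MonoidAlgebra ℤ (Abelianization (FundamentalGroup K.complement ν.basePoint)))
        →ₗ[MonoidAlgebra ℤ (Abelianization (FundamentalGroup K.complement ν.basePoint))]
        alexanderModule (FundamentalGroup K.complement ν.basePoint))
      (A Bm : Matrix (Fin r) (Fin r) ℤ),
      (∀ g, e' (Abelianization.of g) = (windingHom f ν.basePoint g)⁻¹) ∧ Surjective pres ∧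
      LinearMap.ker pres = Submodule.span _
        (Set.range ((Bm.map (LaurentPolynomial.C : ℤ →+* ℤ[T;T⁻¹]) -
          (LaurentPolynomial.T 1 : ℤ[T;T⁻¹]) • A.map (LaurentPolynomial.C : ℤ →+* ℤ[T;T⁻¹])).map
            (laurentEquivOfMulEquiv (FundamentalGroup K.complement ν.basePoint) e').symm)) := by
  -- bases of `H₁(Y)` (rank count) and `H₁(N)`
  obtain ⟨bY⟩ := B.nonempty_basis_Y bL h2 hY hN
  let bN := B.basisN bL
  -- generators of `H₁(N)` and their lifts to the two sides
  let c : Fin r → singularHomology ℤ ℤ ↥B.cutData.N 1 := fun t => bN t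
  have hc : ∀ x : singularHomology ℤ ℤ ↥B.cutData.N 1, ∃ β : Fin r → ℤ, x = ∑ t, β t • c t := fun x =>
    ⟨fun t => bN.repr x t, (bN.sum_repr x).symm.trans
      (Finset.sum_congr rfl fun t _ => int_smul_eq_zsmul _ _ _)⟩
  let bp : Fin r → singularHomology ℤ ℤ ↥B.cutData.plus 1 := fun t =>
    surjInv (B.jPlus_bijective ℤ ℤ 1).2 (c t)
  let bm : Fin r → singularHomology ℤ ℤ ↥B.cutData.minus 1 := fun t =>
    surjInv (B.jMinus_bijective ℤ ℤ 1).2 (c t)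
  have hbp : ∀ t, B.cutData.jPlus ℤ ℤ 1 (bp t) = c t := fun t => surjInv_eq (B.jPlus_bijective ℤ ℤ 1).2 (c t)
  have hbm : ∀ t, B.cutData.jMinus ℤ ℤ 1 (bm t) = c t := fun t => surjInv_eq (B.jMinus_bijective ℤ ℤ 1).2 (c t)
  -- the matrices of the push-offs
  choose A hA using fun t => B.cutData.exists_eq_comb_of_basis bY (B.cutData.iPlus ℤ ℤ 1 (bp t))
  choose Bm hB using fun t => B.cutData.exists_eq_comb_of_basis bY (B.cutData.iMinus ℤ ℤ 1 (bm t))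
  obtain ⟨e', pres, he', hsurj, hker⟩ := ν.exists_alexander_presentation_of_circleBandData f B h₀ bY c hc
    bp bm hbp hbm (Matrix.of A) (Matrix.of Bm) (fun t => hA t) (fun t => hB t)
  exact ⟨e', pres, Matrix.of A, Matrix.of Bm, he', hsurj, hker⟩

end Knot.TubularNbhd

end Literature.Topology.FourManifolds
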